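import Literature.MathematicalPhysics.QuantumFieldTheory.Balaban1983to89.B1Eq324BenfattoSect5Eq515
import HarnessLib

/-!
# `Balaban1983to89.B1Eq324BenfattoClassCrossRowMassMoment` — [BenfattoEtAl1978] §5 (5.7)–(5.8), (5.13)–(5.15) p. 154–155 for the class of
# [Balaban1985BackgroundPropagators] Sect. E p. 428: the `(1 + d(Δ, I))²`-MOMENT of the cross-row mass of a class precision across the §5
# pavement — the `T`-side budget of the temperature-zero decoupling, |B|·poly(L)-extensive and exponentially small in the corridor width, PROVED

statement-level skeleton of published theorems with citation tags; proofs where landed; nothing here is a claim about the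
Yang–Mills mass gap

WHY THIS MODULE (cell `pub-ymgap`, width seat `dag-n08-w5`; sequel of `…B1Eq324BenfattoClassCrossRowMass`; node N08 [Balaban1985UV3]).  The
temperature-zero class substitute for (5.13) (`…KernelComparisonBounded` §3, seat n08-d gen 12; Bochner twins `…KernelComparisonBochner`) pays
`e^{±(ρ + T/2)}` with `ρ = (Σ_y r_y)/(γ − r_max)` and a bounded-fluctuation budget `T` which, on the support of the §5 cut-offs
`|z_y| ≤ b(1 + d(Δ_y, I))` and with the conditional centre profile `|u_Γ(ξ)_y| ≤ C_u b(1 + d(Δ_y, I))`, reads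
`T ≥ (1 + C_u)²b²·Σ_y r_y(1 + d(Δ_y, I))²` (seat n08-d gen 13's displayed row `hT` of its class (5.15)).  The previous file supplies
`r_y := J/(cosh(κ·max(w, d(Δ_y, ⋃_{m∈B} □_m))) − 1)` and the plain budget `Σ_y r_y`; this file supplies the MOMENT `Σ_y r_y(1 + d(Δ_y, I))²`
under the one geometric hypothesis print's pavement satisfies — every tessera of the family `B` meets `I` (for [BenfattoEtAl1978] `B` is the set
of tesserae meeting `J ⊆ I`) — in the form `(2J/(1 − e^{−κw})²)·e^{−κw/2}·(|B|·L^d)·(2(1 + √d(L − 1))² + 128/κ²)·V_d(κ/4)`: extensive in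
the NUMBER OF BOXES times `poly(L)`, independent of `|Λ|`, exponentially small in `w`.  The one new geometric input is that the cube distance
is Lipschitz in either argument for the Euclidean norm of the displacement (the norm argument of `…CondCentre.abs_cubeDist_step_sub_le`, there for
unit steps), so that `d(Δ_y, I) ≤ cubeDist y x + √d(L − 1)` for every site `x` of a tessera meeting `I`.

WHAT IS PROVED (standard axioms; no `sorry`; no definition).
* §1 `abs_cubeDist_sub_cubeDist_le_sqrt` (`|cubeDist y x − cubeDist y x′| ≤ √(Σ_j (x_j − x′_j)²)`), `cubeDist_le_cubeDist_add_of_mem_box`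
  (`x, x′ ∈ □_m ⇒ cubeDist y x ≤ cubeDist y x′ + √d(L − 1)`), `distToRegion_le_cubeDist_add_of_box_meets` (`□_m ∩ I ≠ ∅`, `x ∈ □_m ⇒
  d(Δ_y, I) ≤ cubeDist y x + √d(L − 1)`).
* §2 `add_sq_mul_exp_neg_le` (`t ≥ 0, s > 0 ⇒ (a + t)²e^{−st} ≤ 2a² + 8/s²`, via the kernel `t²e^{−st} ≤ 4/s²`).
* §3 ★★ `sum_crossRow_mul_sq_le_of_class_pavement` — for `κ > 0`, `J ≥ 0`, `0 < L`, `0 < w`, `B` non-empty with every `□_m` (`m ∈ B`) meeting `I`: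
  `Σ_{y∈Λ∖Γ₁} r_y(1 + d(Δ_y, I))² ≤ (2J/(1 − e^{−κw})²)·e^{−κw/2}·(|B|·L^d)·(2(1 + √d(L − 1))² + 128/κ²)·V_d(κ/4)`.
HONEST SCOPE.  Lattice geometry plus elementary real inequalities; the class and the substitute for (5.13) are OURS, not print; nothing of
[Balaban1985UV3] / [Balaban1985UV2] is asserted; no generalised Basic Lemma is stated; the §5-side port is not begun here; count-neutral for
N08; nothing about d = 4, the continuum, OS axioms, a mass gap or the Clay problem.
-/

noncomputable section

open Finset
open scoped BigOperators

namespace Literature.MathematicalPhysics.QuantumFieldTheory.Balaban1983to89.B1Eq324BenfattoClassCrossRowMassMoment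

open Literature.MathematicalPhysics.QuantumFieldTheory.Balaban1983to89.B1Eq324BenfattoLemma
open Literature.MathematicalPhysics.QuantumFieldTheory.Balaban1983to89.B1Eq324BenfattoAppendixA (cubeDist_nonneg distToRegion_nonneg)
open Literature.MathematicalPhysics.QuantumFieldTheory.Balaban1983to89.B1Eq324BenfattoConnLength (cubeDist_comm sum_exp_neg_mul_cubeDist_le)
open Literature.MathematicalPhysics.QuantumFieldTheory.Balaban1983to89.B1Eq324BenfattoSect5Boxes
open Literature.MathematicalPhysics.QuantumFieldTheory.Balaban1983to89.B1Eq324BenfattoSect5Eq524 (card_shrink_le)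

variable {d : ℕ}

/-! ## §1  The cube distance is Lipschitz; distance to `I` from inside a tessera meeting `I` -/

section Lipschitz

/-- kernel: the per-axis gap `max(|t| − 1, 0)` is 1-Lipschitz. [folklore] -/
private theorem abs_gap_sub_gap_le (s t : ℝ) : |max (|s| - 1) 0 - max (|t| - 1) 0| ≤ |s - t| := by
  refine (abs_max_sub_max_le_max (|s| - 1) 0 (|t| - 1) 0).trans ?_
  rw [sub_self, abs_zero, sub_sub_sub_cancel_right]
  exact max_le (abs_abs_sub_abs_le_abs_sub s t) (abs_nonneg _)

/-- kernel: the cube distance as a Euclidean norm of the gap vector. [folklore] -/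
private theorem sqrt_sum_sq_eq_norm (f : Fin d → ℝ) :
    Real.sqrt (∑ j, f j ^ 2) = ‖(WithLp.toLp 2 f : EuclideanSpace ℝ (Fin d))‖ := by
  rw [EuclideanSpace.norm_eq]
  congr 1
  refine Finset.sum_congr rfl fun j _ => ?_
  rw [show (WithLp.toLp 2 f : EuclideanSpace ℝ (Fin d)) j = f j from rfl, Real.norm_eq_abs, sq_abs]

/-- **The cube distance is 1-Lipschitz in its second argument for the Euclidean norm of the displacement**:
`|cubeDist y x − cubeDist y x′| ≤ √(Σ_j (x_j − x′_j)²)` (each per-axis gap is 1-Lipschitz; the Euclidean norm is 1-Lipschitz).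
[cite: BenfattoEtAl1978, after (2.3) p.146] -/
theorem abs_cubeDist_sub_cubeDist_le_sqrt (y x x' : B1Eq324BenfattoLemma.Site d) :
    |cubeDist y x - cubeDist y x'| ≤ Real.sqrt (∑ j, (((x j : ℝ) - (x' j : ℝ))) ^ 2) := by
  set g : Fin d → ℝ := fun j => max (|((y j : ℝ) - (x j : ℝ))| - 1) 0 with hg
  set g' : Fin d → ℝ := fun j => max (|((y j : ℝ) - (x' j : ℝ))| - 1) 0 with hg'
  have h1 : cubeDist y x = ‖(WithLp.toLp 2 g : EuclideanSpace ℝ (Fin d))‖ := sqrt_sum_sq_eq_norm g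
  have h2 : cubeDist y x' = ‖(WithLp.toLp 2 g' : EuclideanSpace ℝ (Fin d))‖ := sqrt_sum_sq_eq_norm g'
  rw [h1, h2]
  refine (abs_norm_sub_norm_le _ _).trans ?_
  have hdiff : (WithLp.toLp 2 g : EuclideanSpace ℝ (Fin d)) - WithLp.toLp 2 g' = WithLp.toLp 2 (g - g') := rfl
  rw [hdiff, ← sqrt_sum_sq_eq_norm (g - g')]
  refine Real.sqrt_le_sqrt (Finset.sum_le_sum fun j _ => ?_)
  have hj : |(g - g') j| ≤ |((x j : ℝ) - (x' j : ℝ))| := by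
    have h := abs_gap_sub_gap_le ((y j : ℝ) - (x j : ℝ)) ((y j : ℝ) - (x' j : ℝ))
    have hxx : ((y j : ℝ) - (x j : ℝ)) - ((y j : ℝ) - (x' j : ℝ)) = -(((x j : ℝ) - (x' j : ℝ))) := by ring
    rw [hxx, abs_neg] at h
    simpa only [Pi.sub_apply, hg, hg'] using h
  calc (g - g') j ^ 2 = |(g - g') j| ^ 2 := (sq_abs _).symm
    _ ≤ |((x j : ℝ) - (x' j : ℝ))| ^ 2 := pow_le_pow_left₀ (abs_nonneg _) hj 2
    _ = (((x j : ℝ) - (x' j : ℝ))) ^ 2 := sq_abs _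

/-- **Inside one tessera the cube distance moves by at most `√d(L − 1)`**: for `x, x′ ∈ □_m` (side `L ≥ 1`),
`cubeDist y x ≤ cubeDist y x′ + √d·(L − 1)`. [cite: BenfattoEtAl1978, (5.7) p.154, after (2.3) p.146] -/
theorem cubeDist_le_cubeDist_add_of_mem_box {L : ℕ} (hL : 0 < L) {m₁ x x' : B1Eq324BenfattoLemma.Site d}
    (hx : x ∈ box L m₁) (hx' : x' ∈ box L m₁) (y : B1Eq324BenfattoLemma.Site d) :
    cubeDist y x ≤ cubeDist y x' + Real.sqrt d * ((L : ℝ) - 1) := by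
  have hL1 : (0 : ℝ) ≤ (L : ℝ) - 1 := by
    have : (1 : ℝ) ≤ L := by exact_mod_cast hL
    linarith
  rw [mem_box_iff] at hx hx'
  have hcoord : ∀ j, (((x j : ℝ) - (x' j : ℝ))) ^ 2 ≤ ((L : ℝ) - 1) ^ 2 := by
    intro j
    obtain ⟨h1, h2⟩ := hx j
    obtain ⟨h3, h4⟩ := hx' j
    have h5 : x j - x' j ≤ (L : ℤ) - 1 := by linarith
    have h6 : x' j - x j ≤ (L : ℤ) - 1 := by linarith
    have h5' : ((x j : ℝ) - (x' j : ℝ)) ≤ (L : ℝ) - 1 := by exact_mod_cast h5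
    have h6' : ((x' j : ℝ) - (x j : ℝ)) ≤ (L : ℝ) - 1 := by exact_mod_cast h6
    have habs : |((x j : ℝ) - (x' j : ℝ))| ≤ (L : ℝ) - 1 := abs_sub_le_iff.mpr ⟨h5', h6'⟩
    calc (((x j : ℝ) - (x' j : ℝ))) ^ 2 = |((x j : ℝ) - (x' j : ℝ))| ^ 2 := (sq_abs _).symm
      _ ≤ ((L : ℝ) - 1) ^ 2 := pow_le_pow_left₀ (abs_nonneg _) habs 2
  have hsum : ∑ j, (((x j : ℝ) - (x' j : ℝ))) ^ 2 ≤ (d : ℝ) * ((L : ℝ) - 1) ^ 2 := by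
    calc ∑ j, (((x j : ℝ) - (x' j : ℝ))) ^ 2 ≤ ∑ _j : Fin d, ((L : ℝ) - 1) ^ 2 := Finset.sum_le_sum fun j _ => hcoord j
      _ = (d : ℝ) * ((L : ℝ) - 1) ^ 2 := by rw [Finset.sum_const, Finset.card_univ, Fintype.card_fin, nsmul_eq_mul]
  have hsqrt : Real.sqrt (∑ j, (((x j : ℝ) - (x' j : ℝ))) ^ 2) ≤ Real.sqrt d * ((L : ℝ) - 1) := by
    calc Real.sqrt (∑ j, (((x j : ℝ) - (x' j : ℝ))) ^ 2) ≤ Real.sqrt ((d : ℝ) * ((L : ℝ) - 1) ^ 2) := Real.sqrt_le_sqrt hsum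
      _ = Real.sqrt d * ((L : ℝ) - 1) := by rw [Real.sqrt_mul (Nat.cast_nonneg d), Real.sqrt_sq hL1]
  have h := abs_cubeDist_sub_cubeDist_le_sqrt y x x'
  have h' := (abs_sub_le_iff.mp (h.trans hsqrt)).1
  linarith

/-- kernel: `d(Δ_y, I) ≤ cubeDist y x` for `x ∈ I` (as in `…ClassCrossRowMass.distToRegion_le_cubeDist`). [folklore] -/
private theorem distToRegion_le_cubeDist {I : Finset (B1Eq324BenfattoLemma.Site d)} {x : B1Eq324BenfattoLemma.Site d} (hx : x ∈ I)
    (y : B1Eq324BenfattoLemma.Site d) : distToRegion I y ≤ cubeDist y x := by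
  rw [distToRegion, dif_pos ⟨x, hx⟩]
  exact Finset.inf'_le _ hx

/-- **Distance to `I` from near a tessera that meets `I`**: if `□_m` contains a site of `I`, then for every `x ∈ □_m` and every `y`,
`d(Δ_y, I) ≤ cubeDist y x + √d·(L − 1)`. [cite: BenfattoEtAl1978, (5.7) p.154, after (2.3) p.146] -/
theorem distToRegion_le_cubeDist_add_of_box_meets {L : ℕ} (hL : 0 < L) {I : Finset (B1Eq324BenfattoLemma.Site d)}
    {m₁ x xI : B1Eq324BenfattoLemma.Site d} (hx : x ∈ box L m₁) (hxI : xI ∈ box L m₁) (hxII : xI ∈ I)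
    (y : B1Eq324BenfattoLemma.Site d) :
    distToRegion I y ≤ cubeDist y x + Real.sqrt d * ((L : ℝ) - 1) :=
  (distToRegion_le_cubeDist hxII y).trans (cubeDist_le_cubeDist_add_of_mem_box hL hxI hx y)

end Lipschitz

/-! ## §2  Elementary: polynomial moments against an exponential -/

section Elementary

/-- kernel: `cosh t − 1 = e^{t}(1 − e^{−t})²/2`. [folklore] -/
private theorem cosh_sub_one_eq_exp_mul (t : ℝ) : Real.cosh t - 1 = Real.exp t * (1 - Real.exp (-t)) ^ 2 / 2 := by
  rw [Real.cosh_eq]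
  have h : Real.exp t * Real.exp (-t) = 1 := by rw [← Real.exp_add, add_neg_cancel, Real.exp_zero]
  linear_combination ((2 - Real.exp (-t)) / 2) * h

/-- kernel: for `t ≥ t₀ ≥ 0`, `(1 − e^{−t₀})²/2 · e^{t} ≤ cosh t − 1`. [folklore] -/
private theorem exp_mul_le_cosh_sub_one {t₀ t : ℝ} (ht₀ : 0 ≤ t₀) (h : t₀ ≤ t) :
    (1 - Real.exp (-t₀)) ^ 2 / 2 * Real.exp t ≤ Real.cosh t - 1 := by
  rw [cosh_sub_one_eq_exp_mul]
  have h1 : 1 - Real.exp (-t₀) ≤ 1 - Real.exp (-t) := by linarith [Real.exp_le_exp.mpr (neg_le_neg h)]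
  have h0 : 0 ≤ 1 - Real.exp (-t₀) := by linarith [Real.exp_le_one_iff.mpr (neg_nonpos.mpr ht₀)]
  have h2 : (1 - Real.exp (-t₀)) ^ 2 ≤ (1 - Real.exp (-t)) ^ 2 := pow_le_pow_left₀ h0 h1 2
  have h3 := Real.exp_pos t
  nlinarith

/-- kernel: for `t ≥ t₀ > 0`, `(cosh t − 1)⁻¹ ≤ 2(1 − e^{−t₀})⁻²·e^{−t}` (as in `…ClassCrossRowMass.inv_cosh_sub_one_le_exp`). [folklore] -/
private theorem inv_cosh_sub_one_le_exp {t₀ t : ℝ} (ht₀ : 0 < t₀) (h : t₀ ≤ t) :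
    (Real.cosh t - 1)⁻¹ ≤ 2 / (1 - Real.exp (-t₀)) ^ 2 * Real.exp (-t) := by
  have h0 : 0 < 1 - Real.exp (-t₀) := by linarith [Real.exp_lt_one_iff.mpr (neg_neg_of_pos ht₀)]
  have hc0 : 0 < (1 - Real.exp (-t₀)) ^ 2 / 2 * Real.exp t := by positivity
  calc (Real.cosh t - 1)⁻¹ ≤ ((1 - Real.exp (-t₀)) ^ 2 / 2 * Real.exp t)⁻¹ := inv_anti₀ hc0 (exp_mul_le_cosh_sub_one ht₀.le h)
    _ = 2 / (1 - Real.exp (-t₀)) ^ 2 * Real.exp (-t) := by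
        rw [Real.exp_neg t, mul_inv, inv_div]

/-- kernel: `t²e^{−st} ≤ 4/s²` for `t ≥ 0`, `s > 0` (from `1 + u ≤ e^u` at `u = st/2`; the same elementary fact is landed as
`Literature.NumberTheory.LFunctions.NumberField.sq_mul_exp_neg_le`, not imported here to keep the lattice files free of the L-function tree). [folklore] -/
private theorem sq_mul_exp_neg_le {s t : ℝ} (hs : 0 < s) (ht : 0 ≤ t) : t ^ 2 * Real.exp (-(s * t)) ≤ 4 / s ^ 2 := by
  have h1 : s * t / 2 ≤ Real.exp (s * t / 2) := by linarith [Real.add_one_le_exp (s * t / 2)]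
  have h2 : 0 ≤ s * t / 2 := by positivity
  have h3 : (s * t / 2) ^ 2 ≤ Real.exp (s * t / 2) ^ 2 := pow_le_pow_left₀ h2 h1 2
  have h4 : Real.exp (s * t / 2) ^ 2 = Real.exp (s * t) := by rw [← Real.exp_nat_mul]; ring_nf
  have h5 : Real.exp (s * t) * Real.exp (-(s * t)) = 1 := by rw [← Real.exp_add, add_neg_cancel, Real.exp_zero]
  have h6 : 0 < Real.exp (-(s * t)) := Real.exp_pos _
  rw [h4] at h3
  -- `s²t²/4 ≤ e^{st}` ⇒ `t² e^{−st} ≤ 4/s²`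
  rw [le_div_iff₀ (by positivity : (0 : ℝ) < s ^ 2)]
  nlinarith [mul_le_mul_of_nonneg_right h3 h6.le]

/-- **`(a + t)²e^{−st} ≤ 2a² + 8/s²` for `t ≥ 0`, `s > 0` (any real `a`).** [folklore] [cite: BenfattoEtAl1978, (5.11) p.155 (class substitute; ours)] -/
theorem add_sq_mul_exp_neg_le {s a t : ℝ} (hs : 0 < s) (ht : 0 ≤ t) :
    (a + t) ^ 2 * Real.exp (-(s * t)) ≤ 2 * a ^ 2 + 8 / s ^ 2 := by
  have h1 := sq_mul_exp_neg_le hs ht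
  have h2 : Real.exp (-(s * t)) ≤ 1 := Real.exp_le_one_iff.mpr (by nlinarith)
  have h3 : 0 < Real.exp (-(s * t)) := Real.exp_pos _
  have h4 : (a + t) ^ 2 ≤ 2 * a ^ 2 + 2 * t ^ 2 := by nlinarith [sq_nonneg (a - t)]
  calc (a + t) ^ 2 * Real.exp (-(s * t)) ≤ (2 * a ^ 2 + 2 * t ^ 2) * Real.exp (-(s * t)) :=
        mul_le_mul_of_nonneg_right h4 h3.le
    _ = 2 * a ^ 2 * Real.exp (-(s * t)) + 2 * (t ^ 2 * Real.exp (-(s * t))) := by ring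
    _ ≤ 2 * a ^ 2 * 1 + 2 * (4 / s ^ 2) := add_le_add (mul_le_mul_of_nonneg_left h2 (by positivity))
        (mul_le_mul_of_nonneg_left h1 (by norm_num))
    _ = 2 * a ^ 2 + 8 / s ^ 2 := by ring

end Elementary

/-! ## §3  The `(1 + d(Δ, I))²`-moment of the cross-row mass across the pavement -/

section Moment

/-- kernel: `e^{−c·d(Δ_y, P)} ≤ Σ_{x∈P} e^{−c·cubeDist y x}` for `P` non-empty. [folklore] -/
private theorem exp_neg_mul_distToRegion_le_sum {P : Finset (B1Eq324BenfattoLemma.Site d)} (hP : P.Nonempty) (c : ℝ)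
    (y : B1Eq324BenfattoLemma.Site d) :
    Real.exp (-(c * distToRegion P y)) ≤ ∑ x ∈ P, Real.exp (-(c * cubeDist y x)) := by
  obtain ⟨x, hx, hxeq⟩ := Finset.exists_mem_eq_inf' hP (cubeDist y)
  have hd : distToRegion P y = cubeDist y x := by rw [distToRegion, dif_pos hP, hxeq]
  rw [hd]
  exact Finset.single_le_sum (f := fun x => Real.exp (-(c * cubeDist y x))) (fun _ _ => (Real.exp_pos _).le) hx

/-- kernel: `e^{−κ·max(w, D)} ≤ e^{−κw/2}·e^{−(κ/2)·D}` for `κ ≥ 0`. [folklore] -/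
private theorem exp_neg_mul_max_le {κ w D : ℝ} (hκ : 0 ≤ κ) :
    Real.exp (-(κ * max w D)) ≤ Real.exp (-(κ * w / 2)) * Real.exp (-(κ / 2 * D)) := by
  rw [← Real.exp_add, Real.exp_le_exp]
  have h1 : w ≤ max w D := le_max_left _ _
  have h2 : D ≤ max w D := le_max_right _ _
  nlinarith

/-- kernel: the pavement `⋃_{m∈B} □_m` has at most `|B|·L^d` sites. [folklore] -/
private theorem card_biUnion_box_le (L : ℕ) (B : Finset (B1Eq324BenfattoLemma.Site d)) :
    ((B.biUnion (box L)).card : ℝ) ≤ (B.card : ℝ) * (L : ℝ) ^ d := by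
  have h1 : (B.biUnion (box L)).card ≤ ∑ m₁ ∈ B, (box L m₁).card := Finset.card_biUnion_le
  have h2 : ∑ m₁ ∈ B, (box L m₁).card ≤ ∑ _m₁ ∈ B, L ^ d :=
    Finset.sum_le_sum fun m₁ _ => by simpa only [shrink_zero] using card_shrink_le L m₁ 0
  have h3 : ∑ _m₁ ∈ B, L ^ d = B.card * L ^ d := by rw [Finset.sum_const, smul_eq_mul]
  exact_mod_cast h1.trans (h2.trans h3.le)

/-- kernel: the weighted lattice sum around one site of a tessera meeting `I`:
`Σ_{y∈S} e^{−(κ/2)cubeDist y x}(1 + d(Δ_y, I))² ≤ (2(1 + √d(L−1))² + 128/κ²)·V_d(κ/4)`. [folklore] -/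
private theorem sum_exp_mul_sq_le {κ : ℝ} (hκ : 0 < κ) {L : ℕ} (hL : 0 < L) {I : Finset (B1Eq324BenfattoLemma.Site d)}
    {m₁ x xI : B1Eq324BenfattoLemma.Site d} (hx : x ∈ box L m₁) (hxI : xI ∈ box L m₁) (hxII : xI ∈ I)
    (S : Finset (B1Eq324BenfattoLemma.Site d)) :
    ∑ y ∈ S, Real.exp (-(κ / 2 * cubeDist y x)) * (1 + distToRegion I y) ^ 2 ≤
      (2 * (1 + Real.sqrt d * ((L : ℝ) - 1)) ^ 2 + 128 / κ ^ 2) *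
        (2 / (1 - Real.exp (-(κ / 4 / Real.sqrt d))) * Real.exp (κ / 4 / Real.sqrt d)) ^ d := by
  set a : ℝ := 1 + Real.sqrt d * ((L : ℝ) - 1) with ha
  have hL1 : (0 : ℝ) ≤ (L : ℝ) - 1 := by
    have : (1 : ℝ) ≤ L := by exact_mod_cast hL
    linarith
  have hκ4 : 0 < κ / 4 := by positivity
  -- per site: `(1 + d_I(y))² e^{−(κ/2)t} ≤ (2a² + 128/κ²) e^{−(κ/4)t}`, `t = cubeDist y x`
  have hterm : ∀ y, Real.exp (-(κ / 2 * cubeDist y x)) * (1 + distToRegion I y) ^ 2 ≤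
      (2 * a ^ 2 + 128 / κ ^ 2) * Real.exp (-(κ / 4 * cubeDist x y)) := by
    intro y
    have ht : 0 ≤ cubeDist y x := cubeDist_nonneg y x
    have hdI : 1 + distToRegion I y ≤ a + cubeDist y x := by
      have := distToRegion_le_cubeDist_add_of_box_meets hL hx hxI hxII y
      rw [ha]; linarith
    have hdI0 : 0 ≤ 1 + distToRegion I y := by linarith [distToRegion_nonneg I y]
    have hsq : (1 + distToRegion I y) ^ 2 ≤ (a + cubeDist y x) ^ 2 := pow_le_pow_left₀ hdI0 hdI 2
    have hsplit : Real.exp (-(κ / 2 * cubeDist y x)) = Real.exp (-(κ / 4 * cubeDist y x)) * Real.exp (-(κ / 4 * cubeDist y x)) := by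
      rw [← Real.exp_add]; ring_nf
    have hel := add_sq_mul_exp_neg_le (a := a) hκ4 ht
    have h128 : 2 * a ^ 2 + 8 / (κ / 4) ^ 2 = 2 * a ^ 2 + 128 / κ ^ 2 := by
      field_simp
      ring
    rw [h128] at hel
    rw [cubeDist_comm x y]
    calc Real.exp (-(κ / 2 * cubeDist y x)) * (1 + distToRegion I y) ^ 2
        ≤ Real.exp (-(κ / 2 * cubeDist y x)) * (a + cubeDist y x) ^ 2 := mul_le_mul_of_nonneg_left hsq (Real.exp_pos _).le
      _ = ((a + cubeDist y x) ^ 2 * Real.exp (-(κ / 4 * cubeDist y x))) * Real.exp (-(κ / 4 * cubeDist y x)) := by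
          rw [hsplit]; ring
      _ ≤ (2 * a ^ 2 + 128 / κ ^ 2) * Real.exp (-(κ / 4 * cubeDist y x)) :=
          mul_le_mul_of_nonneg_right hel (Real.exp_pos _).le
  have hgrowth := sum_exp_neg_mul_cubeDist_le hκ4 S x
  have hc0 : 0 ≤ 2 * a ^ 2 + 128 / κ ^ 2 := by positivity
  calc ∑ y ∈ S, Real.exp (-(κ / 2 * cubeDist y x)) * (1 + distToRegion I y) ^ 2
      ≤ ∑ y ∈ S, (2 * a ^ 2 + 128 / κ ^ 2) * Real.exp (-(κ / 4 * cubeDist x y)) := Finset.sum_le_sum fun y _ => hterm y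
    _ = (2 * a ^ 2 + 128 / κ ^ 2) * ∑ y ∈ S, Real.exp (-(κ / 4 * cubeDist x y)) := by rw [Finset.mul_sum]
    _ ≤ (2 * a ^ 2 + 128 / κ ^ 2) *
          (2 / (1 - Real.exp (-(κ / 4 / Real.sqrt d))) * Real.exp (κ / 4 / Real.sqrt d)) ^ d :=
        mul_le_mul_of_nonneg_left hgrowth hc0

/-- **THE `(1 + d(Δ, I))²`-MOMENT OF THE CROSS-ROW MASS ACROSS THE §5 PAVEMENT** — the `T`-side budget of the temperature-zero decoupling.
With `r y := J/(cosh(κ·max(w, d(Δ_y, ⋃_{m∈B} □_m))) − 1)` (`…ClassCrossRowMass.cross_rowSum_le_of_class_pavement`), `κ > 0`, `J ≥ 0`, `0 < L`,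
`0 < w`, `B` non-empty and EVERY tessera of `B` meeting `I` (print: `B` = the tesserae meeting `J ⊆ I`):
`Σ_{y ∈ Λ∖Γ₁} r_y·(1 + d(Δ_y, I))² ≤ (2J/(1 − e^{−κw})²)·e^{−κw/2}·(|B|·L^d)·(2(1 + √d(L − 1))² + 128/κ²)·V_d(κ/4)`, `V_d(c) = (2e^{c/√d}/(1 − e^{−c/√d}))^d`
— so seat n08-d's row `hT : (1 + C_u)²b²·Σ_y r_y(1 + d(Δ_y, I))² ≤ T` holds with a `T` that is |B|·poly(L)-EXTENSIVE, independent of `|Λ|`, and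
exponentially small in the corridor width `w`. [cite: BenfattoEtAl1978, §5 (5.7)–(5.8) p.154–155, (5.11) p.155, (5.13)–(5.15) p.155 (class substitute; ours)] -/
theorem sum_crossRow_mul_sq_le_of_class_pavement {Λ : Finset (B1Eq324BenfattoLemma.Site d)} {κ J : ℝ} (hκ : 0 < κ) (hJ : 0 ≤ J)
    {L w : ℕ} (hL : 0 < L) (hw : 0 < w) {B : Finset (B1Eq324BenfattoLemma.Site d)} (hB : B.Nonempty)
    {I : Finset (B1Eq324BenfattoLemma.Site d)} (hBI : ∀ m₁ ∈ B, ∃ x ∈ box L m₁, x ∈ I) :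
    ∑ y : ↥(Λ \ corridors L w B), J / (Real.cosh (κ * max (w : ℝ) (distToRegion (B.biUnion (box L)) y)) - 1) *
        (1 + distToRegion I y) ^ 2 ≤
      2 * J / (1 - Real.exp (-(κ * w))) ^ 2 * Real.exp (-(κ * w / 2)) * ((B.card : ℝ) * (L : ℝ) ^ d) *
        ((2 * (1 + Real.sqrt d * ((L : ℝ) - 1)) ^ 2 + 128 / κ ^ 2) *
          (2 / (1 - Real.exp (-(κ / 4 / Real.sqrt d))) * Real.exp (κ / 4 / Real.sqrt d)) ^ d) := by
  set P : Finset (B1Eq324BenfattoLemma.Site d) := B.biUnion (box L) with hP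
  set W : ℝ := (2 * (1 + Real.sqrt d * ((L : ℝ) - 1)) ^ 2 + 128 / κ ^ 2) *
    (2 / (1 - Real.exp (-(κ / 4 / Real.sqrt d))) * Real.exp (κ / 4 / Real.sqrt d)) ^ d with hW
  set C : ℝ := 2 * J / (1 - Real.exp (-(κ * w))) ^ 2 with hC
  have hw' : (0 : ℝ) < w := by exact_mod_cast hw
  have hκw : 0 < κ * w := mul_pos hκ hw'
  have hC0 : 0 ≤ C := by
    rw [hC]
    exact div_nonneg (by positivity) (sq_nonneg _)
  have hPne : P.Nonempty := by
    obtain ⟨m₁, hm₁⟩ := hB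
    obtain ⟨x, hx, -⟩ := hBI m₁ hm₁
    exact ⟨x, Finset.mem_biUnion.mpr ⟨m₁, hm₁, hx⟩⟩
  -- Step 1: per site, `r_y ≤ C e^{−κw/2} Σ_{x∈P} e^{−(κ/2) cubeDist y x}`
  have hr : ∀ y : ↥(Λ \ corridors L w B),
      J / (Real.cosh (κ * max (w : ℝ) (distToRegion P y)) - 1) ≤
        C * Real.exp (-(κ * w / 2)) * ∑ x ∈ P, Real.exp (-(κ / 2 * cubeDist (y : B1Eq324BenfattoLemma.Site d) x)) := by
    intro y
    have hmax : (w : ℝ) ≤ max (w : ℝ) (distToRegion P y) := le_max_left _ _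
    have h1 : (Real.cosh (κ * max (w : ℝ) (distToRegion P y)) - 1)⁻¹ ≤
        2 / (1 - Real.exp (-(κ * w))) ^ 2 * Real.exp (-(κ * max (w : ℝ) (distToRegion P y))) :=
      inv_cosh_sub_one_le_exp hκw (mul_le_mul_of_nonneg_left hmax hκ.le)
    have h2 : Real.exp (-(κ * max (w : ℝ) (distToRegion P y))) ≤
        Real.exp (-(κ * w / 2)) * Real.exp (-(κ / 2 * distToRegion P y)) := exp_neg_mul_max_le hκ.le
    have h3 : Real.exp (-(κ / 2 * distToRegion P y)) ≤
        ∑ x ∈ P, Real.exp (-(κ / 2 * cubeDist (y : B1Eq324BenfattoLemma.Site d) x)) :=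
      exp_neg_mul_distToRegion_le_sum hPne (κ / 2) y
    have h20 : 0 ≤ 2 / (1 - Real.exp (-(κ * w))) ^ 2 := by positivity
    calc J / (Real.cosh (κ * max (w : ℝ) (distToRegion P y)) - 1)
        = J * (Real.cosh (κ * max (w : ℝ) (distToRegion P y)) - 1)⁻¹ := div_eq_mul_inv _ _
      _ ≤ J * (2 / (1 - Real.exp (-(κ * w))) ^ 2 * Real.exp (-(κ * max (w : ℝ) (distToRegion P y)))) :=
          mul_le_mul_of_nonneg_left h1 hJ
      _ ≤ J * (2 / (1 - Real.exp (-(κ * w))) ^ 2 * (Real.exp (-(κ * w / 2)) * Real.exp (-(κ / 2 * distToRegion P y)))) :=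
          mul_le_mul_of_nonneg_left (mul_le_mul_of_nonneg_left h2 h20) hJ
      _ ≤ J * (2 / (1 - Real.exp (-(κ * w))) ^ 2 * (Real.exp (-(κ * w / 2)) *
            ∑ x ∈ P, Real.exp (-(κ / 2 * cubeDist (y : B1Eq324BenfattoLemma.Site d) x)))) :=
          mul_le_mul_of_nonneg_left (mul_le_mul_of_nonneg_left
            (mul_le_mul_of_nonneg_left h3 (Real.exp_pos _).le) h20) hJ
      _ = C * Real.exp (-(κ * w / 2)) * ∑ x ∈ P, Real.exp (-(κ / 2 * cubeDist (y : B1Eq324BenfattoLemma.Site d) x)) := by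
          rw [hC]; ring
  -- Step 2: the weighted double sum, swapped, is at most `|P|·W`
  have hswap : ∑ y : ↥(Λ \ corridors L w B), (∑ x ∈ P, Real.exp (-(κ / 2 * cubeDist (y : B1Eq324BenfattoLemma.Site d) x))) *
      (1 + distToRegion I y) ^ 2 ≤ (P.card : ℝ) * W := by
    have hrew : ∀ y : ↥(Λ \ corridors L w B),
        (∑ x ∈ P, Real.exp (-(κ / 2 * cubeDist (y : B1Eq324BenfattoLemma.Site d) x))) * (1 + distToRegion I y) ^ 2 =
          ∑ x ∈ P, Real.exp (-(κ / 2 * cubeDist (y : B1Eq324BenfattoLemma.Site d) x)) * (1 + distToRegion I y) ^ 2 :=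
      fun y => Finset.sum_mul _ _ _
    simp only [hrew]
    rw [Finset.sum_comm]
    calc ∑ x ∈ P, ∑ y : ↥(Λ \ corridors L w B),
          Real.exp (-(κ / 2 * cubeDist (y : B1Eq324BenfattoLemma.Site d) x)) * (1 + distToRegion I y) ^ 2
        ≤ ∑ _x ∈ P, W := Finset.sum_le_sum fun x hx => by
          obtain ⟨m₁, hm₁, hxm⟩ := Finset.mem_biUnion.mp hx
          obtain ⟨xI, hxI, hxII⟩ := hBI m₁ hm₁
          have h := sum_exp_mul_sq_le hκ hL hxm hxI hxII (Λ \ corridors L w B)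
          rw [← Finset.sum_coe_sort (Λ \ corridors L w B)] at h
          exact h
      _ = (P.card : ℝ) * W := by rw [Finset.sum_const, nsmul_eq_mul]
  -- Step 3: assemble
  have hE0 : 0 ≤ C * Real.exp (-(κ * w / 2)) := mul_nonneg hC0 (Real.exp_pos _).le
  have hW0 : 0 ≤ W := by
    rw [hW]
    have hq : 0 ≤ κ / 4 / Real.sqrt d := div_nonneg (by positivity) (Real.sqrt_nonneg _)
    have hb : 0 ≤ 1 - Real.exp (-(κ / 4 / Real.sqrt d)) := by
      linarith [Real.exp_le_one_iff.mpr (neg_nonpos.mpr hq)]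
    have hV0 : 0 ≤ (2 / (1 - Real.exp (-(κ / 4 / Real.sqrt d))) * Real.exp (κ / 4 / Real.sqrt d)) ^ d :=
      pow_nonneg (mul_nonneg (div_nonneg zero_le_two hb) (Real.exp_pos _).le) d
    have hL1 : (0 : ℝ) ≤ (L : ℝ) - 1 := by
      have : (1 : ℝ) ≤ L := by exact_mod_cast hL
      linarith
    have : 0 ≤ 2 * (1 + Real.sqrt d * ((L : ℝ) - 1)) ^ 2 + 128 / κ ^ 2 := by positivity
    exact mul_nonneg this hV0
  calc ∑ y : ↥(Λ \ corridors L w B), J / (Real.cosh (κ * max (w : ℝ) (distToRegion P y)) - 1) * (1 + distToRegion I y) ^ 2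
      ≤ ∑ y : ↥(Λ \ corridors L w B), (C * Real.exp (-(κ * w / 2)) *
          ∑ x ∈ P, Real.exp (-(κ / 2 * cubeDist (y : B1Eq324BenfattoLemma.Site d) x))) * (1 + distToRegion I y) ^ 2 :=
        Finset.sum_le_sum fun y _ => mul_le_mul_of_nonneg_right (hr y) (sq_nonneg _)
    _ = C * Real.exp (-(κ * w / 2)) * ∑ y : ↥(Λ \ corridors L w B),
          (∑ x ∈ P, Real.exp (-(κ / 2 * cubeDist (y : B1Eq324BenfattoLemma.Site d) x))) * (1 + distToRegion I y) ^ 2 := by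
        rw [Finset.mul_sum]
        refine Finset.sum_congr rfl fun y _ => ?_
        ring
    _ ≤ C * Real.exp (-(κ * w / 2)) * ((P.card : ℝ) * W) := mul_le_mul_of_nonneg_left hswap hE0
    _ ≤ C * Real.exp (-(κ * w / 2)) * (((B.card : ℝ) * (L : ℝ) ^ d) * W) :=
        mul_le_mul_of_nonneg_left (mul_le_mul_of_nonneg_right (card_biUnion_box_le L B) hW0) hE0
    _ = C * Real.exp (-(κ * w / 2)) * ((B.card : ℝ) * (L : ℝ) ^ d) * W := by ring

end Moment

/-! ## §4 (v1.1, APPEND-ONLY)  The Euclidean site distance: the glue to the class rows of record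

Seat n08-d gen 13 LOCATED (2026-08-28T07:43Z) that the class rows of record for a §5 chain are to be stated in the EUCLIDEAN site distance
`ℓ²(x, y) = √(Σ_j (x_j − y_j)²)` (a genuine metric — `cubeDist` is not a pseudometric: `d(Δ_0, Δ_2) = 1 > d(Δ_0, Δ_1) + d(Δ_1, Δ_2) = 0`),
because J1 F5 `…KernelOfPrecision.abs_condMean_kernel_le_profile` needs a triangle inequality and a 1-Lipschitz profile.  The three lemmas below
are the glue between those rows and the `cubeDist`-currency suppliers of `…ClassCrossRowMass` / this file: `cubeDist ≤ ℓ²`; `d(Δ_·, I)` is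
1-Lipschitz for `ℓ²`; and an `ℓ²` Combes–Thomas row implies the `cubeDist` Combes–Thomas row `hJ` of `…ClassCrossRowMass.cross_rowSum_le_of_class_pavement`
(monotonicity of `cosh`). -/

section EuclideanGlue

open Literature.MathematicalPhysics.QuantumFieldTheory.Balaban1983to89.B1Eq324BenfattoSect5SlotMoments (cubeDist_self)

/-- **`cubeDist x y ≤ ℓ²(x, y) = √(Σ_j (x_j − y_j)²)`** (each per-axis gap `max(|x_j − y_j| − 1, 0) ≤ |x_j − y_j|`; equivalently §1's Lipschitz
bound at `x′ := y` with `cubeDist y y = 0`). [cite: BenfattoEtAl1978, after (2.3) p.146] -/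
theorem cubeDist_le_sqrt_sum_sq (x y : B1Eq324BenfattoLemma.Site d) :
    cubeDist x y ≤ Real.sqrt (∑ j, (((x j : ℝ) - (y j : ℝ))) ^ 2) := by
  have h := abs_cubeDist_sub_cubeDist_le_sqrt y x y
  rw [cubeDist_self, sub_zero, cubeDist_comm] at h
  exact (le_abs_self _).trans h

/-- **`d(Δ_·, I)` is 1-Lipschitz for the Euclidean site distance**: `|d(Δ_x, I) − d(Δ_y, I)| ≤ √(Σ_j (x_j − y_j)²)` (an infimum of functions
each 1-Lipschitz by §1's `abs_cubeDist_sub_cubeDist_le_sqrt`, the infimum being attained on the finite region `I`) — the profile hypothesis of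
J1 F5 `abs_condMean_kernel_le_profile` at `δ := distToRegion I` in the `ℓ²` metric. [cite: BenfattoEtAl1978, after (2.3) p.146; Appendix C (C.8) p.164] -/
theorem abs_distToRegion_sub_distToRegion_le_sqrt (I : Finset (B1Eq324BenfattoLemma.Site d)) (x y : B1Eq324BenfattoLemma.Site d) :
    |distToRegion I x - distToRegion I y| ≤ Real.sqrt (∑ j, (((x j : ℝ) - (y j : ℝ))) ^ 2) := by
  by_cases hI : I.Nonempty
  · -- one-sided bound from the minimiser of the other point
    have hone : ∀ x y : B1Eq324BenfattoLemma.Site d,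
        distToRegion I x - distToRegion I y ≤ Real.sqrt (∑ j, (((x j : ℝ) - (y j : ℝ))) ^ 2) := by
      intro x y
      obtain ⟨z, hz, hzeq⟩ := Finset.exists_mem_eq_inf' hI (cubeDist y)
      have hdy : distToRegion I y = cubeDist y z := by rw [distToRegion, dif_pos hI, hzeq]
      have hdx : distToRegion I x ≤ cubeDist x z := distToRegion_le_cubeDist hz x
      have hlip := abs_cubeDist_sub_cubeDist_le_sqrt z x y
      rw [cubeDist_comm z x, cubeDist_comm z y] at hlip
      have h1 := (abs_sub_le_iff.mp hlip).1
      linarith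
    refine abs_sub_le_iff.mpr ⟨hone x y, ?_⟩
    have h := hone y x
    have hsymm : Real.sqrt (∑ j, (((y j : ℝ) - (x j : ℝ))) ^ 2) = Real.sqrt (∑ j, (((x j : ℝ) - (y j : ℝ))) ^ 2) := by
      congr 1
      exact Finset.sum_congr rfl fun j _ => by ring
    rw [hsymm] at h
    exact h
  · have h0 : ∀ x : B1Eq324BenfattoLemma.Site d, distToRegion I x = 0 := fun x => by rw [distToRegion, dif_neg hI]
    rw [h0 x, h0 y, sub_zero, abs_zero]
    exact Real.sqrt_nonneg _

/-- **An `ℓ²` Combes–Thomas row implies the `cubeDist` Combes–Thomas row** (`θ ≥ 0`):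
`Σ_{e′}|A e e′|(cosh(θ·cubeDist e e′) − 1) ≤ Σ_{e′}|A e e′|(cosh(θ·ℓ²(e, e′)) − 1)` — so the class row of record
`Σ_{e′}|A e e′|(cosh(θ·ℓ²(e,e′)) − 1) ≤ J` yields the hypothesis `hJ` of `…ClassCrossRowMass.cross_rowSum_le_of_class_pavement` with the same `J`.
[cite: BenfattoEtAl1978, §5 (5.13) p.155 (class substitute; ours); Balaban1985BackgroundPropagators, Sect. E p.428] -/
theorem rowDefect_cubeDist_le_of_sqrt {Λ : Finset (B1Eq324BenfattoLemma.Site d)} (A : Matrix Λ Λ ℝ) {θ : ℝ} (hθ : 0 ≤ θ) (e : Λ) :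
    ∑ e' : Λ, |A e e'| * (Real.cosh (θ * cubeDist (e : B1Eq324BenfattoLemma.Site d) (e' : B1Eq324BenfattoLemma.Site d)) - 1) ≤
      ∑ e' : Λ, |A e e'| *
        (Real.cosh (θ * Real.sqrt (∑ j, (((e : B1Eq324BenfattoLemma.Site d) j : ℝ) - ((e' : B1Eq324BenfattoLemma.Site d) j : ℝ)) ^ 2)) - 1) := by
  refine Finset.sum_le_sum fun e' _ => mul_le_mul_of_nonneg_left ?_ (abs_nonneg _)
  have hc : 0 ≤ θ * cubeDist (e : B1Eq324BenfattoLemma.Site d) (e' : B1Eq324BenfattoLemma.Site d) :=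
    mul_nonneg hθ (cubeDist_nonneg _ _)
  have hle : θ * cubeDist (e : B1Eq324BenfattoLemma.Site d) (e' : B1Eq324BenfattoLemma.Site d) ≤
      θ * Real.sqrt (∑ j, (((e : B1Eq324BenfattoLemma.Site d) j : ℝ) - ((e' : B1Eq324BenfattoLemma.Site d) j : ℝ)) ^ 2) :=
    mul_le_mul_of_nonneg_left (cubeDist_le_sqrt_sum_sq _ _) hθ
  have hcosh := Real.cosh_le_cosh.mpr (show |θ * cubeDist (e : B1Eq324BenfattoLemma.Site d) (e' : B1Eq324BenfattoLemma.Site d)| ≤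
      |θ * Real.sqrt (∑ j, (((e : B1Eq324BenfattoLemma.Site d) j : ℝ) - ((e' : B1Eq324BenfattoLemma.Site d) j : ℝ)) ^ 2)| by
    rw [abs_of_nonneg hc, abs_of_nonneg (hc.trans hle)]; exact hle)
  linarith

/-- **The `ℓ²` row of record discharges `hJ`**: if `Σ_{e′}|A e e′|(cosh(θ·ℓ²(e,e′)) − 1) ≤ J` for all `e` (`θ ≥ 0`), then
`Σ_{e′}|A e e′|(cosh(θ·cubeDist e e′) − 1) ≤ J` for all `e`. [cite: BenfattoEtAl1978, §5 (5.13) p.155 (class substitute; ours)] -/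
theorem rowDefect_cubeDist_le_of_rowDefect_sqrt {Λ : Finset (B1Eq324BenfattoLemma.Site d)} {A : Matrix Λ Λ ℝ} {θ J : ℝ} (hθ : 0 ≤ θ)
    (hJ : ∀ e : Λ, ∑ e' : Λ, |A e e'| *
      (Real.cosh (θ * Real.sqrt (∑ j, (((e : B1Eq324BenfattoLemma.Site d) j : ℝ) - ((e' : B1Eq324BenfattoLemma.Site d) j : ℝ)) ^ 2)) - 1) ≤ J)
    (e : Λ) :
    ∑ e' : Λ, |A e e'| * (Real.cosh (θ * cubeDist (e : B1Eq324BenfattoLemma.Site d) (e' : B1Eq324BenfattoLemma.Site d)) - 1) ≤ J :=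
  (rowDefect_cubeDist_le_of_sqrt A hθ e).trans (hJ e)

end EuclideanGlue

end Literature.MathematicalPhysics.QuantumFieldTheory.Balaban1983to89.B1Eq324BenfattoClassCrossRowMassMoment
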